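import Summits.AtomisticToContinuum.HydrodynamicLimit.Theses.RelayRaceLocality
import Literature.MathematicalPhysics.KineticTheory.HardSphereEulerSolutionGluing
import Literature.Analysis.FunctionSpaces.TorusSpaceTime

/-!
# Disproof of `RestartPrinciple` (stmt-AtomisticToContinuum-12503) — findings

Work file of the crux disprover (cdisprove, cycle 1, 2026-08-16). Crux decl
`Summit.AtomisticToContinuum.HydrodynamicLimit.Theses.RelayRaceLocality.RestartPrinciple`, route
`RelayRaceLocality`, line `Sketch` (lead `prover-line-stmt-AtomisticToContinuum-12503-0`).

The decl is LITERALLY `AntecedentS → ConsequentG` (`restartPrinciple_iff`, by `Iff.rfl`):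
* `AntecedentS` (`S`): the short-time guarded hydrodynamic limit from local-Gibbs TIME-0 data,
  prefix `∃ η₀ ∀ M ∃ τ₁ ∀ profile ∃ σ₀ ∀ σ < σ₀`;
* `ConsequentG` (`G`): the packing-guarded conjunct (= body of stmt-AtomisticToContinuum-3093,
  `HydroLimitInBand`).

## Findings (sorry-free unless marked NEAR-MISS)

1. TIGHTNESS / ANATOMY. `consequentG_imp_antecedentS : G → S` (restrict the classical solution to
   `[0, T')`, `T' > t` — tree lemma `IsHardSphereEulerSolution.restrict` — keeping the strict packing
   guard by the tube lemma over the compact torus, `exists_packing_extension`). Hence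
   `restartPrinciple_iff_iff : RestartPrinciple ↔ (S ↔ G)` and
   `not_restartPrinciple_iff : ¬ RestartPrinciple ↔ (S ∧ ¬ G)`:
   ANY DISPROOF MUST *PROVE* THE SHORT-TIME HYDRODYNAMIC LIMIT `S` (open, junk-free) AND *REFUTE* THE
   GUARDED CONJUNCT `G` (open, junk-free). This is the precise sense in which the crux resists.
2. LOAD-BEARING PREFIX (schema theorems, explicit witnesses). With `S`'s shape — time-0 anchoring
   and `σ₀` chosen under `∀ M` — "`S`-shape ⇒ `G`-shape" is FALSE even for honest restartable
   dynamics: `anchored_schema_false` (witness `L t := t < 1`), `prefixMfirst_schema_false` (witness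
   `L σ t := σ * t ≤ 1`, size `s ↦ s`: LLN up to time `σ⁻¹`, size unbounded like the `C³` size at a
   first shock). With the corrected prefix (`σ₀` before `M`, restart from any `s₀`) the schema HOLDS:
   `restart_induction`. So no proof of the crux can consume `S` as a black box; the only content is a
   re-proof of the short-time limit in restartable currency, i.e. the line's `stub_restartableHL`.
3. JUNK AVENUES CLOSED (why no cheap counter-model exists): the laws are `≪ liouville`
   (`localGibbsLaw_absolutelyContinuous`), so the unspecified values of `HardSphereFlow.flow` off the
   good set are invisible to `TendstoHydroFieldsAt`; `T ≤ 0` and unsatisfied guards are vacuous on BOTH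
   sides of the implication (`consequentG_body_of_nonpos`); the velocity–time scaling
   `(x, v, θ, t) ↦ (x, λv, λ²θ, t/λ)` maps `S` to `S` with `M ↦ max(λ², λ³…) M` (two-sided θ-guard pins
   the scale) — no bootstrap; constant profiles are invariant Gibbs laws on both sides.
4. LINE `Sketch` (lead's skeleton v1, `Lines/Sketch.lean`): joint sufficiency is honest —
   `RestartPrinciple_of := fun _ => guardedConjunct_of_stubs` discards `S` and proves `G` outright from
   `stub_restartableHL` (= `restart_induction` instantiated) + `stub_finiteSize` (TRUE, elementary:
   `IsSmoothSpaceTimeOn.exists_norm_le_of_isCompact`, `.partialDeriv`, positivity + compactness for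
   `θ ≥ M⁻¹`). No stub is refutable by degenerate instances (`T ≤ 0`, empty guards, `σ`-ranges are all
   vacuous-true). THE BET IS EQUIVALENT TO `G`: `consequentG_imp_stubRestartableHL : G → stub` (§5)
   and `stub ∧ finiteSize → G` (Sketch). Targets: none stuck (payload `stuck_stubs = []`).
5. NEAR-MISSES: none claimed. No `sorry` in this file. §6: regimes examined and what a kill needs.

Landed under `Theorems/RestartPrinciple/Negative/` (namespace `…Theorems.RestartPrincipleNegative`,
importable by ideators / planners / the lead):
`RestartSchema.lean` (p99454 ACCEPTED: §3), `ConsequentImpAntecedent.lean` (p101123 ACCEPTED: §2,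
`exists_packing_extension`, `guardedConjunct_imp_shortTimeGuardedHL`, `not_restartPrinciple_iff`,
`not_restartPrinciple_iff_not_iff`), `StubRestartableHLOfGuardedConjunct.lean` (p103746: §5,
`guardedConjunct_imp_stubRestartableHL`).
-/

noncomputable section

open Literature.MathematicalPhysics.KineticTheory Literature.Analysis.FluidPDE
open Literature.Analysis.FunctionSpaces MeasureTheory Filter Set Topology
open Summit.AtomisticToContinuum.HydrodynamicLimit.Theses.RelayRaceLocality

namespace Summit.AtomisticToContinuum.HydrodynamicLimit.Cruxes.RestartPrinciple.Disproof

/-! ## §1 Anatomy: `RestartPrinciple = (S → G)` -/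

/-- `S`, the antecedent of the crux: the short-time guarded hydrodynamic limit from local-Gibbs
time-0 data (verbatim first half of the route decl). -/
def AntecedentS : Prop :=
  ∃ η₀ : ℝ, 0 < η₀ ∧ ∀ M : ℝ, 0 < M → ∃ τ₁ : ℝ, 0 < τ₁ ∧ ∀ (a₀ θ₀ : T3 → ℝ) (u₀ : T3 → V3), Continuous a₀ → Continuous θ₀ → Continuous u₀ → (∀ x, 0 < a₀ x) → (∀ x, 0 < θ₀ x) → ∃ σ₀ : ℝ, 0 < σ₀ ∧ ∀ σ : ℝ, 0 < σ → σ < σ₀ → ∀ (T : ℝ) (ρ θ : ℝ → T3 → ℝ) (u : ℝ → T3 → V3), IsHardSphereEulerSolution σ T ρ u θ → ∀ Φ : (N : ℕ) → HardSphereFlow (Torus.geometry (Fin 3)) (hsDiameter σ N) (N + 1), TendstoHydroFieldsAt (fun N => localGibbsLaw σ a₀ u₀ θ₀ N (Φ N)) Φ ρ u θ 0 → ∀ t ∈ Set.Ico 0 (min T τ₁), (∀ s ∈ Set.Icc 0 t, ∀ x, ρ s x * σ ^ 3 < η₀ ∧ ρ s x ≤ M ∧ θ s x ≤ M ∧ M⁻¹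 ≤ θ s x ∧ ‖u s x‖ ≤ M ∧ ∀ i j k : Fin 3, |Torus.partialDeriv i (ρ s) x| ≤ M ∧ ‖Torus.partialDeriv i (u s) x‖ ≤ M ∧ |Torus.partialDeriv i (θ s) x| ≤ M ∧ |Torus.partialDeriv i (Torus.partialDeriv j (ρ s)) x| ≤ M ∧ ‖Torus.partialDeriv i (Torus.partialDeriv j (u s)) x‖ ≤ M ∧ |Torus.partialDeriv i (Torus.partialDeriv j (θ s)) x| ≤ M ∧ |Torus.partialDeriv i (Torus.partialDeriv j (Torus.partialDeriv k (ρ s))) x| ≤ M ∧ ‖Torus.partialDeriv i (Torus.partialDeriv j (Torus.partialDeriv k (u s))) x‖ ≤ M ∧ |Torus.partialDeriv i (Torus.partialDeriv j (Torus.partialDeriv k (θ s))) x| ≤ M) → TendstoHydroFieldsAt (fun N => localGibbsLaw σ a₀ u₀ θ₀ N (Φ N)) Φ ρ u θ t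

/-- `G`, the consequent of the crux: the packing-guarded conjunct (verbatim second half of the route
decl; = body of stmt-AtomisticToContinuum-3093). -/
def ConsequentG : Prop :=
  ∃ η₀ : ℝ, 0 < η₀ ∧ ∀ (a₀ θ₀ : T3 → ℝ) (u₀ : T3 → V3), Continuous a₀ → Continuous θ₀ → Continuous u₀ → (∀ x, 0 < a₀ x) → (∀ x, 0 < θ₀ x) → ∃ σ₀ : ℝ, 0 < σ₀ ∧ ∀ σ : ℝ, 0 < σ → σ < σ₀ → ∀ (T : ℝ) (ρ θ : ℝ → T3 → ℝ) (u : ℝ → T3 → V3), IsHardSphereEulerSolution σ T ρ u θ → (∀ t ∈ Set.Ico 0 T, ∀ x, ρ t x * σ ^ 3 < η₀) → ∀ Φ : (N : ℕ) → HardSphereFlow (Torus.geometry (Fin 3)) (hsDiameter σ N) (N + 1), TendstoHydroFieldsAt (fun N => localGibbsLaw σ a₀ u₀ θ₀ N (Φ N)) Φ ρ u θ 0 → ∀ t ∈ Set.Ico 0 T, TendstoHydroFieldsAt (fun N => localGibbsLaw σ a₀ u₀ θ₀ N (Φ N)) Φ ρ u θ t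

/-- The crux is literally the implication `S → G`. -/
theorem restartPrinciple_iff : RestartPrinciple ↔ (AntecedentS → ConsequentG) := Iff.rfl

/-! ## §2 Tightness: `G → S` (restriction of classical solutions), hence `RP ↔ (S ↔ G)` -/

/-- A strict packing bound on the compact slab `[0, t] × 𝕋³` of a classical solution extends to
`[0, T')` for some `T' ∈ (t, T]` (max over the compact torus at time `t` + tube lemma in time). -/
theorem exists_packing_extension {σ T : ℝ} {ρ θ : ℝ → T3 → ℝ} {u : ℝ → T3 → V3}
    (h : IsHardSphereEulerSolution σ T ρ u θ) {η₀ t : ℝ} (ht : t ∈ Ico 0 T)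
    (hpack : ∀ s ∈ Icc 0 t, ∀ x, ρ s x * σ ^ 3 < η₀) (hσ : 0 < σ) :
    ∃ T' : ℝ, t < T' ∧ T' ≤ T ∧ ∀ s ∈ Ico 0 T', ∀ x, ρ s x * σ ^ 3 < η₀ := by
  have hcont : Continuous (ρ t) := (h.smooth_density.isSmooth_slice ht).continuous
  obtain ⟨x₀, -, hx₀⟩ := isCompact_univ.exists_isMaxOn univ_nonempty hcont.continuousOn
  have hσ3 : 0 < σ ^ 3 := pow_pos hσ 3
  have hR : ρ t x₀ < η₀ / σ ^ 3 := by
    rw [lt_div_iff₀ hσ3]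
    exact hpack t ⟨ht.1, le_rfl⟩ x₀
  set ε : ℝ := (η₀ / σ ^ 3 - ρ t x₀) / 2 with hε
  have hεpos : 0 < ε := by rw [hε]; linarith
  have hev := h.smooth_density.eventually_norm_sub_lt ht hεpos
  obtain ⟨δ, hδ, hδε⟩ := Metric.mem_nhdsWithin_iff.1 hev
  refine ⟨min T (t + δ), lt_min ht.2 (by linarith), min_le_left _ _, fun s hs x => ?_⟩
  by_cases hst : s ≤ t
  · exact hpack s ⟨hs.1, hst⟩ x
  · push Not at hst
    have hsT : s ∈ Ico 0 T := ⟨hs.1, lt_of_lt_of_le hs.2 (min_le_left _ _)⟩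
    have hdist : s ∈ Metric.ball t δ := by
      rw [Metric.mem_ball, Real.dist_eq, abs_of_pos (sub_pos.2 hst)]
      linarith [lt_of_lt_of_le hs.2 (min_le_right _ _)]
    have hmem : s ∈ {s | ∀ x, ‖ρ s x - ρ t x‖ < ε} := hδε ⟨hdist, hsT⟩
    have hnear : ‖ρ s x - ρ t x‖ < ε := hmem x
    have h1 : ρ s x < ρ t x + ε := by
      rw [Real.norm_eq_abs] at hnear
      linarith [(abs_lt.1 hnear).2]
    have h2 : ρ t x ≤ ρ t x₀ := hx₀ (mem_univ x)
    have h3 : ρ t x₀ + ε < η₀ / σ ^ 3 := by rw [hε]; linarith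
    have h4 : ρ s x < η₀ / σ ^ 3 := by linarith
    rwa [lt_div_iff₀ hσ3] at h4

/-- TIGHTNESS: the consequent of the crux implies its antecedent. -/
theorem consequentG_imp_antecedentS : ConsequentG → AntecedentS := by
  rintro ⟨η₀, hη₀, hG⟩
  refine ⟨η₀, hη₀, fun M _ => ⟨1, one_pos, fun a₀ θ₀ u₀ ha hθ hu ha0 hθ0 => ?_⟩⟩
  obtain ⟨σ₀, hσ₀, hG⟩ := hG a₀ θ₀ u₀ ha hθ hu ha0 hθ0
  refine ⟨σ₀, hσ₀, fun σ hσ hσσ₀ T ρ θ u hsol Φ h0 t ht hguard => ?_⟩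
  have htT : t ∈ Ico 0 T := ⟨ht.1, lt_of_lt_of_le ht.2 (min_le_left _ _)⟩
  obtain ⟨T', htT', hT'T, hpack⟩ :=
    exists_packing_extension hsol htT (fun s hs x => (hguard s hs x).1) hσ
  exact hG σ hσ hσσ₀ T' ρ θ u (hsol.restrict hT'T) hpack Φ h0 t ⟨ht.1, htT'⟩

/-- The crux is equivalent to the EQUIVALENCE of its two halves. -/
theorem restartPrinciple_iff_iff : RestartPrinciple ↔ (AntecedentS ↔ ConsequentG) :=
  ⟨fun h => ⟨h, consequentG_imp_antecedentS⟩, fun h => h.1⟩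

/-- WHAT A DISPROOF IS: exactly a proof of the short-time limit `S` together with a refutation of the
guarded conjunct `G`. -/
theorem not_restartPrinciple_iff : ¬ RestartPrinciple ↔ (AntecedentS ∧ ¬ ConsequentG) := by
  rw [restartPrinciple_iff]
  exact Classical.not_imp

/-- The two (and only two) ways to PROVE the crux: refute `S`, or prove `G`. (Kept here, not under
`Theorems/…/Negative/`, because the conclusion is the crux itself.) -/
theorem restartPrinciple_of_not_antecedentS (h : ¬ AntecedentS) : RestartPrinciple :=
  fun hS => absurd hS h

theorem restartPrinciple_of_consequentG (h : ConsequentG) : RestartPrinciple := fun _ => h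

/-! ## §3 Load-bearing quantifier prefix: schema (non-)entailments

Abstract the crux: `L σ t` = "the LLN holds at time `t` at reduced density `σ`", `size σ t` = the
`C³` size of the classical solution at time `t` (finite at every `t < T`, unbounded at a first shock).
-/

/-- RESTART DEFECT (time-0 anchoring): a short-time statement that only restarts from time `0`
(as `S` does: its law is the local Gibbs law at time `0`) entails nothing beyond `τ₁`.
Witness `L t := t < 1`, `τ₁ := 1`. -/
theorem anchored_schema_false :
    ¬ ∀ L : ℝ → Prop, (∃ τ₁ : ℝ, 0 < τ₁ ∧ (L 0 → ∀ t ∈ Ico (0 : ℝ) τ₁, L t)) →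
        (L 0 → ∀ t : ℝ, 0 ≤ t → L t) := by
  intro h
  have h1 : (1 : ℝ) < 1 :=
    h (fun t => t < 1) ⟨1, one_pos, fun _ t ht => ht.2⟩ (by norm_num) 1 zero_le_one
  exact lt_irrefl _ h1

/-- PREFIX DEFECT (`σ₀` under `∀ M`, as in `S`): even a RESTARTABLE short-time statement (restart
from any `s₀ ≥ 0`, honest semigroup shape) with `S`'s prefix `∀ M ∃ τ₁ ∃ σ₀(M) ∀ σ < σ₀` does not
entail the `G`-shape `∃ σ₀ ∀ σ < σ₀ ∀ t`, because the size of the solution at the times to be reached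
is not bounded when `σ₀` is chosen. Witness: `L σ t := σ * t ≤ 1` (LLN up to time `σ⁻¹`),
`size σ s := s`. -/
theorem prefixMfirst_schema_false :
    ¬ ∀ (L : ℝ → ℝ → Prop) (size : ℝ → ℝ → ℝ),
      (∀ M : ℝ, 0 < M → ∃ τ₁ : ℝ, 0 < τ₁ ∧ ∃ σ₀ : ℝ, 0 < σ₀ ∧ ∀ σ : ℝ, 0 < σ → σ < σ₀ →
          ∀ s₀ : ℝ, 0 ≤ s₀ → L σ s₀ → ∀ t ∈ Ico s₀ (s₀ + τ₁),
            (∀ s ∈ Icc 0 t, size σ s ≤ M) → L σ t) →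
      (∀ σ t : ℝ, ∃ M : ℝ, 0 < M ∧ ∀ s ∈ Icc 0 t, size σ s ≤ M) →
      ∃ σ₀ : ℝ, 0 < σ₀ ∧ ∀ σ : ℝ, 0 < σ → σ < σ₀ → L σ 0 → ∀ t : ℝ, 0 ≤ t → L σ t := by
  intro h
  have hS : ∀ M : ℝ, 0 < M → ∃ τ₁ : ℝ, 0 < τ₁ ∧ ∃ σ₀ : ℝ, 0 < σ₀ ∧ ∀ σ : ℝ, 0 < σ → σ < σ₀ →
      ∀ s₀ : ℝ, 0 ≤ s₀ → σ * s₀ ≤ 1 → ∀ t ∈ Ico s₀ (s₀ + τ₁),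
        (∀ s ∈ Icc 0 t, s ≤ M) → σ * t ≤ 1 := by
    intro M hM
    refine ⟨1, one_pos, 1 / (M + 1), by positivity, fun σ hσ hσlt s₀ hs₀ _ t ht hguard => ?_⟩
    have htM : t ≤ M := hguard t ⟨hs₀.trans ht.1, le_rfl⟩
    have h1 : σ * (M + 1) < 1 := by rwa [lt_div_iff₀ (by positivity)] at hσlt
    have h2 : σ * t ≤ σ * M := mul_le_mul_of_nonneg_left htM hσ.le
    have h3 : σ * (M + 1) = σ * M + σ := by ring
    linarith
  have hsize : ∀ σ t : ℝ, ∃ M : ℝ, 0 < M ∧ ∀ s ∈ Icc 0 t, s ≤ M := fun σ t =>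
    ⟨max t 1, lt_max_of_lt_right one_pos, fun s hs => hs.2.trans (le_max_left t 1)⟩
  obtain ⟨σ₀, hσ₀, hG⟩ := h (fun σ t => σ * t ≤ 1) (fun _ s => s) hS hsize
  have hσ : 0 < σ₀ / 2 := half_pos hσ₀
  have h0 : σ₀ / 2 * 0 ≤ 1 := by norm_num
  have hbad : σ₀ / 2 * (4 / σ₀) ≤ 1 := hG (σ₀ / 2) hσ (half_lt_self hσ₀) h0 (4 / σ₀) (by positivity)
  have hval : σ₀ / 2 * (4 / σ₀) = 2 := by field_simp; ring
  linarith

/-- THE CORRECTED SCHEMA HOLDS (`σ` fixed, restart from any `s₀`, size finite at every time): finite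
restart induction over the grid `k · τ₁ / 2`. This is the abstract form of the lead's
`guardedConjunct_of_stubs` (line `Sketch`): `stub_restartableHL` = `hstep`, `stub_finiteSize` = `hsize`. -/
theorem restart_induction (L : ℝ → Prop) (size : ℝ → ℝ)
    (hstep : ∀ M : ℝ, 0 < M → ∃ τ₁ : ℝ, 0 < τ₁ ∧ ∀ s₀ : ℝ, 0 ≤ s₀ → L s₀ →
        ∀ t ∈ Ico s₀ (s₀ + τ₁), (∀ s ∈ Icc 0 t, size s ≤ M) → L t)
    (hsize : ∀ t : ℝ, ∃ M : ℝ, 0 < M ∧ ∀ s ∈ Icc 0 t, size s ≤ M)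
    (h0 : L 0) : ∀ t : ℝ, 0 ≤ t → L t := by
  intro t ht
  obtain ⟨M, hM, hsz⟩ := hsize t
  obtain ⟨τ₁, hτ₁, hst⟩ := hstep M hM
  have key : ∀ n : ℕ, ∀ s : ℝ, 0 ≤ s → s ≤ t → s ≤ n * (τ₁ / 2) → L s := by
    intro n
    induction n with
    | zero =>
      intro s hs0 _ hsn
      have hs : s = 0 := le_antisymm (by simpa using hsn) hs0
      subst hs
      exact h0
    | succ n ih =>
      intro s hs0 hst' hsn
      by_cases hc : s ≤ n * (τ₁ / 2)
      · exact ih s hs0 hst' hc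
      · push Not at hc
        have hs₀ : 0 ≤ (n : ℝ) * (τ₁ / 2) := by positivity
        refine hst _ hs₀ (ih _ hs₀ (hc.le.trans hst') le_rfl) s ⟨hc.le, ?_⟩ ?_
        · have hcast : ((n + 1 : ℕ) : ℝ) * (τ₁ / 2) = n * (τ₁ / 2) + τ₁ / 2 := by push_cast; ring
          linarith
        · intro s' hs'
          exact hsz s' ⟨hs'.1, hs'.2.trans hst'⟩
  obtain ⟨n, hn⟩ := exists_nat_ge (t / (τ₁ / 2))
  exact key n t ht le_rfl (by rwa [div_le_iff₀ (half_pos hτ₁)] at hn)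

/-! ## §4 Junk avenues closed -/

/-- The local Gibbs laws are absolutely continuous w.r.t. the Liouville measure, so the unspecified
(junk) values of `HardSphereFlow.flow` off the Liouville-conull good set cannot be used to build a
counter-model: `TendstoHydroFieldsAt` only sees the flow `P N`-a.e. -/
theorem localGibbsLaw_absolutelyContinuous (σ : ℝ) (a₀ θ₀ : T3 → ℝ) (u₀ : T3 → V3) (N : ℕ)
    (Φ : HardSphereFlow (Torus.geometry (Fin 3)) (hsDiameter σ N) (N + 1)) :
    localGibbsLaw σ a₀ u₀ θ₀ N Φ ≪ liouville (Torus.geometry (Fin 3)) (N + 1) (hsDiameter σ N) := by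
  unfold localGibbsLaw particleLaw
  exact withDensity_absolutelyContinuous _ _

/-- Degenerate time horizons are vacuous on BOTH sides: for `T ≤ 0` the body of `G` (and of `S`)
holds trivially, so `T ≤ 0` instances neither refute `G` nor make `S` contentful. -/
theorem consequentG_body_of_nonpos {σ T : ℝ} (hT : T ≤ 0) (ρ θ : ℝ → T3 → ℝ) (u : ℝ → T3 → V3)
    (a₀ θ₀ : T3 → ℝ) (u₀ : T3 → V3)
    (Φ : (N : ℕ) → HardSphereFlow (Torus.geometry (Fin 3)) (hsDiameter σ N) (N + 1)) :
    ∀ t ∈ Ico 0 T, TendstoHydroFieldsAt (fun N => localGibbsLaw σ a₀ u₀ θ₀ N (Φ N)) Φ ρ u θ t :=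
  fun _ ht => absurd (ht.1.trans_lt ht.2) (not_lt.2 hT)

/-! ## §5 Line `Sketch` — stub set and joint sufficiency

* `stub_restartableHL` (THE BET): prefix `∃ η₀ ∀ profile ∃ σ₀ ∀ σ < σ₀ ∀ M ∃ τ₁`, restart from any
  `s₀ ∈ [0, T)` given the LLN on `[0, s₀]` along the TRUE law. It is `restart_induction`'s `hstep`
  with `L := TendstoHydroFieldsAt … t`; by `guardedConjunct_of_stubs` (Sketch) it implies `G`, and
  CONVERSELY `G` implies it (`consequentG_imp_stubRestartableHL` below: `τ₁ := 1`, LLN at `0` is among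
  its hypotheses, packing extension + restriction). So, given the true elementary `stub_finiteSize`,
  THE BET IS EQUIVALENT TO `G` (body of the shared open item stmt-3093): the reshaping into
  restartable currency is faithful bookkeeping with zero logical slack either way — no partial credit
  ("restart for short macroscopic times only") lives inside the stub as typed, and whatever proves it
  proves the guarded hydrodynamic limit outright.
  Degenerate instances (`T ≤ 0`; `s₀` with unsatisfiable guards; `M < 1`, where `M⁻¹ ≤ θ ≤ M` is
  unsatisfiable) are all vacuous-TRUE, so no small-model refutation exists; dropping the hypothesis
  "LLN on `[0, s₀]`" or the packing guard gives statements we can neither prove nor refute here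
  (they are hydrodynamic-limit statements for the pushed-forward local Gibbs law).
* `stub_finiteSize`: TRUE (elementary). `ρ, θ, ‖u‖` bounded and `θ ≥ M⁻¹` on `[0, t] × 𝕋³` by
  `IsSmoothSpaceTimeOn.exists_norm_le_of_isCompact` (+ `ContDiffOn.inv` for `θ⁻¹`); the
  `Torus.partialDeriv` iterates are again jointly smooth (`IsSmoothSpaceTimeOn.partialDeriv`,
  `uniqueDiffOn_Ico`), hence bounded the same way. For `t < 0` it is vacuous (`Icc 0 t = ∅`, `M := 1`).
* Joint sufficiency: `RestartPrinciple_of : RestartPrinciple := fun _ => guardedConjunct_of_stubs`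
  is literally `restartPrinciple_of_consequentG`; nothing is smuggled, `S` is (correctly) unused.
-/

/-- LINE `Sketch`: the consequent `G` implies the statement of the lead's `stub_restartableHL`
(verbatim from `Lines/Sketch.lean`), so the bet is no easier than `G`. -/
theorem consequentG_imp_stubRestartableHL : ConsequentG →
    (∃ η₀ : ℝ, 0 < η₀ ∧ ∀ (a₀ θ₀ : T3 → ℝ) (u₀ : T3 → V3), Continuous a₀ → Continuous θ₀ →
      Continuous u₀ → (∀ x, 0 < a₀ x) → (∀ x, 0 < θ₀ x) → ∃ σ₀ : ℝ, 0 < σ₀ ∧ ∀ σ : ℝ, 0 < σ →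
      σ < σ₀ → ∀ M : ℝ, 0 < M → ∃ τ₁ : ℝ, 0 < τ₁ ∧ ∀ (T : ℝ) (ρ θ : ℝ → T3 → ℝ) (u : ℝ → T3 → V3),
      IsHardSphereEulerSolution σ T ρ u θ →
      ∀ Φ : (N : ℕ) → HardSphereFlow (Torus.geometry (Fin 3)) (hsDiameter σ N) (N + 1),
      ∀ s₀ ∈ Set.Ico 0 T,
      (∀ s ∈ Set.Icc 0 s₀,
        TendstoHydroFieldsAt (fun N => localGibbsLaw σ a₀ u₀ θ₀ N (Φ N)) Φ ρ u θ s) →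
      ∀ t ∈ Set.Ico s₀ (min T (s₀ + τ₁)),
      (∀ s ∈ Set.Icc 0 t, ∀ x, ρ s x * σ ^ 3 < η₀ ∧ ρ s x ≤ M ∧ θ s x ≤ M ∧ M⁻¹ ≤ θ s x ∧
        ‖u s x‖ ≤ M ∧ ∀ i j k : Fin 3, |Torus.partialDeriv i (ρ s) x| ≤ M ∧
        ‖Torus.partialDeriv i (u s) x‖ ≤ M ∧ |Torus.partialDeriv i (θ s) x| ≤ M ∧
        |Torus.partialDeriv i (Torus.partialDeriv j (ρ s)) x| ≤ M ∧
        ‖Torus.partialDeriv i (Torus.partialDeriv j (u s)) x‖ ≤ M ∧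
        |Torus.partialDeriv i (Torus.partialDeriv j (θ s)) x| ≤ M ∧
        |Torus.partialDeriv i (Torus.partialDeriv j (Torus.partialDeriv k (ρ s))) x| ≤ M ∧
        ‖Torus.partialDeriv i (Torus.partialDeriv j (Torus.partialDeriv k (u s))) x‖ ≤ M ∧
        |Torus.partialDeriv i (Torus.partialDeriv j (Torus.partialDeriv k (θ s))) x| ≤ M) →
      TendstoHydroFieldsAt (fun N => localGibbsLaw σ a₀ u₀ θ₀ N (Φ N)) Φ ρ u θ t) := by
  rintro ⟨η₀, hη₀, hG⟩
  refine ⟨η₀, hη₀, fun a₀ θ₀ u₀ ha hθ hu ha0 hθ0 => ?_⟩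
  obtain ⟨σ₀, hσ₀, hG⟩ := hG a₀ θ₀ u₀ ha hθ hu ha0 hθ0
  refine ⟨σ₀, hσ₀, fun σ hσ hσσ₀ M _ => ⟨1, one_pos, ?_⟩⟩
  intro T ρ θ u hsol Φ s₀ hs₀ hprev t ht hguard
  have h0 : TendstoHydroFieldsAt (fun N => localGibbsLaw σ a₀ u₀ θ₀ N (Φ N)) Φ ρ u θ 0 :=
    hprev 0 ⟨le_rfl, hs₀.1⟩
  have ht0 : 0 ≤ t := hs₀.1.trans ht.1
  have htT : t ∈ Ico 0 T := ⟨ht0, lt_of_lt_of_le ht.2 (min_le_left _ _)⟩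
  obtain ⟨T', htT', hT'T, hpack⟩ :=
    exists_packing_extension hsol htT (fun s hs x => (hguard s hs x).1) hσ
  exact hG σ hσ hσσ₀ T' ρ θ u (hsol.restrict hT'T) hpack Φ h0 t ⟨ht0, htT'⟩

/-! ## §6 Why it resists — regimes examined (cycle 1) and what a kill would need

By `not_restartPrinciple_iff`, a kill = `S ∧ ¬G`.

* PROVING `S` (short-time LLN from local Gibbs data, uniformly: `τ₁ = τ₁(M)` before the profile,
  `σ₀(M, profile)`): no junk route — the time-0 LLN hypothesis is satisfiable (`localGibbs_lln`), the
  guards are satisfiable for `M ≥ sup θ₀, sup ‖u₀‖, …` and `σ` small, `t = 0` is the only free instance.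
  Any proof is a genuine short-time hydrodynamic limit for deterministic hard spheres (open; Spohn 1991
  Part I Ch. 3).
* REFUTING `G` inside the packing guard and the classical regime: every exact conservation law of the
  particle system is matched by the typed Euler system in divergence form on `𝕋³` (mass, momentum
  `∂ₜ(ρu) + Σᵢ∂ᵢ(ρuᵢu) + ∇p = 0`, energy `∂ₜE + div((E+p)u) = 0`), the hard-core packing obstruction of
  `Theorems/DensityCap/Negative/*` (`ρσ³ ≤ 81/π` wherever an LLN holds) is excluded by the guard
  `ρσ³ < η₀` with `η₀` existential, and the only printed fixed-density long-time mechanism — Alder–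
  Wainwright long-time tails (doi:10.1007/978-1-4899-2314-1_29) — is an integrable `t^{-3/2}`
  correction to TRANSPORT coefficients in 3D, invisible at Euler scaling at fixed macroscopic `t`.
  Linear (Kelvin–Helmholtz) instability of smooth shear solutions amplifies `O(N^{-1/2})` fluctuations
  to `O(1)` only at times `≍ log N → ∞`, not at fixed `t`. No candidate witness.
* Small/finite models: not applicable (all statements are `N → ∞` limits over a continuum flow;
  nothing decidable to `decide`/`kit`).
* Hypothesis mutation of `S` inside `RP`: dropping `S` gives `G` (open); strengthening `S` to the
  restartable prefix gives the line's `stub_restartableHL`, from which `G` follows (`restart_induction`)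
  — so `S` is "possibly unnecessary" in the precise sense `RP ↔ (S ↔ G)` with `G → S` free.
* Literature search this cycle was degraded (local index unavailable, OpenAlex/S2 HTTP 429; crossref
  only): nothing found contradicting `G`; nearest template for a restartable currency remains the
  relative-entropy method with noise (Yau 1991; Olla–Varadhan–Yau 1993), as the planner says.
-/

end Summit.AtomisticToContinuum.HydrodynamicLimit.Cruxes.RestartPrinciple.Disproof

end
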